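import Summits.ValiantsHypothesis.ValiantsHypothesis.Theorems.TwoProducts.RankThreeAffineToricWronskianWords

/-!
# Toric Wronskians of monomials, part 15: WORD ANALYSIS for mixed words — column word-coefficients and letter assignments ((2b-ii)a of val-idea-crit-8 g6 #128/#130)

Sequel of ✓ `…ToricWronskianWords` ((2b-i): `AddIndep`, `toricW_coef_word`).  Two ingredients of the polarised located coefficient (the sequel
`…ToricWronskianMixed`, (L1′)₂):
§1 the Newton-reduced class matrix `𝕄″ = toricWNewtMat` (✓ `…DepthForm`) column by column: ★ `isWordSupp_toricWNewtMat` (entry `(k,i′)` = `k`-letter words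
with `≥ ℓ_{i′}` off-line letters); under `AddIndep (supp u) N`, ★ `coeff_toricWNewtMat_rank_zero` (a rank-0 column at the pure word `v^k` carries `β_{i′}^k`)
and ★ `coeff_toricWNewtMat_rank_one` (a rank-1 column at the word `v^{k−1} ⊔ {p}` carries `toricWLead β_{i′} γ_p κ_p k 1`, `p` any off-line letter).
§2 ★★ `coeff_prod_eq_sum_assign` — THE WORD ANALYSIS: for word sums `G_i` (`k_i` letters, `≥ r_i ∈ {0,1}` off-line) and letters `p_i` on the rank-1
indices (`m + #{r_i = 1} = Σ k_i ≤ N`), under `AddIndep (supp u) N`,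
`coeff_{m•v + Σ_{r_i=1} p_i} (Π_i G_i) = Σ_{f ∈ toricWAssign r p} Π_i coeff_{(k_i − r_i)•v + [r_i=1] f i} G_i`: every surviving decomposition of the
target (✓ `coeff_finset_prod`) is a LETTER ASSIGNMENT — the total word is forced to be `v^m ⊔ {p_i}` (additive independence), each rank-1 factor holds
exactly one off-line letter and each rank-0 factor none (counting `Σ_i #off(w_i) = #{r_i = 1}` against `#off(w_i) ≥ r_i`), and `Finset.sum_bij_ne_zero`
matches decompositions with assignments.  `toricWAssign r p` := functions `f` with `f i ∈ p(R1)` on `R1 = {r = 1}`, `0` elsewhere, and the same letter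
multiset as `p` (for distinct letters: the bijective re-assignments); `toricWDecomp k r v f i := (k_i − r_i)•v + [r_i = 1] f i`.  Small tools:
`toricWNewt_zero_right`, `sum_singleton_eq_map`, `countP_finset_sum`, `filter_finset_sum`, `IsWordSupp.C_mul`.
HONEST LABEL: GP-scoped (AddIndep) engine cell on the OPEN rung 3-AFF (side ladder, crux `stmt-ValiantsHypothesis-5906` `TwoProducts`); `AddIndep` FAILS in the
OLM slot; progress on `ConeTopBound`'s `R` = 0; `ConeTopBound`-uniform, `OLMLaw`, `RankThreeAffineLaw(Exp)`, `TwoProducts`, PCB, `ResidualLawV25` UNMOVED;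
0 summit distance; VP ≠ VNP is NOT proved; no summit statement is proved here.  `--supports stmt-ValiantsHypothesis-5906 --as helper` (val-port-4 g6; critic of
record val-idea-crit-8 g6).  Two data defs with parameters (`toricWAssign`, `toricWDecomp`); no Prop-defs, no instances, no notation, no named facts. [folklore]
-/

noncomputable section
set_option linter.dupNamespace false

namespace Summit.ValiantsHypothesis.ValiantsHypothesis.Theorems.TwoProducts.RankTwoJacobian

open scoped BigOperators
open MvPolynomial
open Literature.LinearAlgebra.Matrix (wronskianMatrix wronskian wronskianMatrix_apply wronskian_def)

section TowerKernel
open scoped Classical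

/-! ### §1 The Newton-reduced columns as word sums, and their word coefficients -/

/-- `C c · F` keeps the word shape. [folklore] -/
theorem IsWordSupp.C_mul {u : Poly2} {q : Expo} {a j : ℕ} {F : Poly2} (hF : IsWordSupp u q a j F) (c : ℂ) : IsWordSupp u q a j (C c * F) :=
  hF.of_support_subset (by rw [← smul_eq_C_mul]; exact MvPolynomial.support_smul)

/-- ★ the `(k, i′)` entry of the Newton-reduced class matrix `𝕄″` is a sum of `k`-letter words with at least `ℓ_{i′}` off-line letters. [folklore] -/
theorem isWordSupp_toricWNewtMat (u : Poly2) (q : Expo) {K : ℕ} (b : Fin K → Expo) (n : Fin K → ℕ) (k i' : Fin K) :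
    IsWordSupp u q k (toricWRank b i') (toricWNewtMat u q b n k i') := by
  unfold toricWNewtMat
  rw [Matrix.of_apply]
  refine isWordSupp_sum _ fun j _ => ?_
  rcases lt_or_ge (j : ℕ) (toricWRank b i') with hj | hj
  · rw [toricWNewt_eq_zero _ _ _ hj, C_0, zero_mul]; exact isWordSupp_zero u q _ _
  · exact ((isWordSupp_toricW_coef u (b i') q k j).mono hj).C_mul _

/-- ★ RANK-0 COLUMNS at the pure word `v^k`: `coeff_{k•v} 𝕄″_{k,i′} = β_{i′}^k` (`ℓ_{i′} = 0`; additive independence up to `k` letters). -/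
theorem coeff_toricWNewtMat_rank_zero {u : Poly2} {v q : Expo} {N : ℕ} (hA : AddIndep u.support N) (hv : v ∈ u.support) (hqv : idet q v = 0)
    {K : ℕ} (b : Fin K → Expo) (n : Fin K → ℕ) (k i' : Fin K) (hk : (k : ℕ) ≤ N) (hr : toricWRank b i' = 0) :
    coeff ((k : ℕ) • v) (toricWNewtMat u q b n k i') = (coeff v u * ((idet (b i') v : ℤ) : ℂ)) ^ (k : ℕ) := by
  unfold toricWNewtMat
  rw [Matrix.of_apply, coeff_sum]
  have hword := toricW_coef_word hA hv hqv (b i') k hk 0 (fun p hp => by simp at hp) (by simp)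
  simp only [Multiset.card_zero, Nat.sub_zero, Multiset.sum_zero, add_zero, toricWLeadS_zero] at hword
  have hK : 0 < K := lt_of_le_of_lt (Nat.zero_le _) k.isLt
  rw [Finset.sum_eq_single_of_mem (⟨0, hK⟩ : Fin K) (Finset.mem_univ _) fun j _ hj => ?_]
  · rw [coeff_C_mul, hr]
    show toricWNewt _ 0 0 * coeff ((k : ℕ) • v) (toricW_coef u (b i') q k 0) = _
    rw [toricWNewt_diag, one_mul, hword]
  · have hj' : 0 < (j : ℕ) := Nat.pos_of_ne_zero fun h => hj (Fin.ext h)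
    rw [coeff_C_mul]
    have hz := (isWordSupp_toricW_coef u (b i') q k j).coeff_eq_zero_of_addIndep hA hk (w₀ := Multiset.replicate k v)
      (fun x hx => by rw [Multiset.eq_of_mem_replicate hx]; exact hv) (Multiset.card_replicate _ _)
      (by rw [Multiset.filter_eq_nil.mpr fun x hx => by rw [Multiset.eq_of_mem_replicate hx]; exact not_not.mpr hqv]; simpa using hj')
    rw [Multiset.sum_replicate] at hz
    rw [hz, mul_zero]

/-- ★ RANK-1 COLUMNS at the word `v^{k−1} ⊔ {p}`: `coeff_{(k−1)•v + p} 𝕄″_{k,i′} = toricWLead β_{i′} γ_p κ_p k 1` (`ℓ_{i′} = 1`, `p` an off-line letter). -/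
theorem coeff_toricWNewtMat_rank_one {u : Poly2} {v q : Expo} {N : ℕ} (hA : AddIndep u.support N) (hv : v ∈ u.support) (hqv : idet q v = 0)
    {K : ℕ} (b : Fin K → Expo) (n : Fin K → ℕ) (k i' : Fin K) (hk : (k : ℕ) ≤ N) (hr : toricWRank b i' = 1)
    {p : Expo} (hp : p ∈ u.support) (hqp : idet q p ≠ 0) :
    coeff (((k : ℕ) - 1) • v + p) (toricWNewtMat u q b n k i') =
      toricWLead (coeff v u * ((idet (b i') v : ℤ) : ℂ)) (coeff v u * ((idet p v : ℤ) : ℂ)) (coeff p u * ((idet q p : ℤ) : ℂ)) k 1 := by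
  unfold toricWNewtMat
  rw [Matrix.of_apply, coeff_sum]
  have hK : 1 < K := by have := toricWRank_lt_card b i'; rw [hr] at this; exact lt_of_lt_of_le this (Finset.card_le_univ _ |>.trans (by simp))
  rcases Nat.eq_zero_or_pos (k : ℕ) with hk0 | hk0
  · -- row 0: every term vanishes
    rw [hk0, toricWLead_eq_zero _ _ _ Nat.zero_lt_one]
    refine Finset.sum_eq_zero fun j _ => ?_
    rcases Nat.eq_zero_or_pos (j : ℕ) with hj | hj
    · rw [hr, hj, toricWNewt_eq_zero _ 0 1 Nat.zero_lt_one, C_0, zero_mul, coeff_zero]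
    · rw [toricW_coef_eq_zero u (b i') q 0 j (by omega), mul_zero, coeff_zero]
  · have hword := toricW_coef_word hA hv hqv (b i') k hk {p} (fun x hx => by rw [Multiset.mem_singleton.mp hx]; exact ⟨hp, hqp⟩)
      (by rw [Multiset.card_singleton]; exact hk0)
    rw [Multiset.card_singleton, Multiset.sum_singleton, toricWLeadS_singleton] at hword
    rw [Finset.sum_eq_single_of_mem (⟨1, hK⟩ : Fin K) (Finset.mem_univ _) fun j _ hj => ?_]
    · rw [coeff_C_mul, hr]
      show toricWNewt _ 1 1 * coeff (((k : ℕ) - 1) • v + p) (toricW_coef u (b i') q k 1) = _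
      rw [toricWNewt_diag, one_mul, hword]
    · rw [coeff_C_mul, hr]
      have hj1 : (j : ℕ) ≠ 1 := fun h => hj (Fin.ext h)
      rcases Nat.lt_or_gt_of_ne hj1 with hlt | hgt
      · rw [toricWNewt_eq_zero _ _ 1 hlt, zero_mul]
      · have hz := (isWordSupp_toricW_coef u (b i') q k j).coeff_eq_zero_of_addIndep hA hk
          (w₀ := Multiset.replicate ((k : ℕ) - 1) v + {p})
          (fun x hx => by
            rcases Multiset.mem_add.mp hx with h | h
            · rw [Multiset.eq_of_mem_replicate h]; exact hv
            · rw [Multiset.mem_singleton.mp h]; exact hp)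
          (by rw [Multiset.card_add, Multiset.card_replicate, Multiset.card_singleton]; omega)
          (by
            rw [Multiset.filter_add, Multiset.filter_eq_nil.mpr fun x hx => by rw [Multiset.eq_of_mem_replicate hx]; exact not_not.mpr hqv,
              zero_add, Multiset.filter_singleton, if_pos hqp, Multiset.card_singleton]
            exact hgt)
        rw [Multiset.sum_add, Multiset.sum_replicate, Multiset.sum_singleton] at hz
        rw [hz, mul_zero]

/-! ### §2 Word analysis: which decompositions of the target word survive in a product of word sums -/

/-- `newt y a 0 = y_0^a`. [folklore] -/
theorem toricWNewt_zero_right (y : ℕ → ℂ) : ∀ a : ℕ, toricWNewt y a 0 = y 0 ^ a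
  | 0 => by simp [toricWNewt]
  | a + 1 => by simp only [toricWNewt, if_true, add_zero]; rw [toricWNewt_zero_right y a, pow_succ]; ring

/-- `Σ_{i∈s} {f i} = s.val.map f` as multisets. [folklore] -/
theorem sum_singleton_eq_map {ι : Type*} (s : Finset ι) (f : ι → Expo) : ∑ i ∈ s, ({f i} : Multiset Expo) = s.val.map f := by
  induction s using Finset.induction_on with
  | empty => simp
  | insert a s ha ih => rw [Finset.sum_insert ha, ih, Finset.insert_val_of_notMem ha, Multiset.map_cons, Multiset.singleton_add]

/-- `countP` is additive over finite sums of multisets. [folklore] -/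
theorem countP_finset_sum {ι : Type*} (s : Finset ι) (P : Expo → Prop) [DecidablePred P] (w : ι → Multiset Expo) :
    Multiset.countP P (∑ i ∈ s, w i) = ∑ i ∈ s, Multiset.countP P (w i) := by
  induction s using Finset.induction_on with
  | empty => simp
  | insert a s ha ih => rw [Finset.sum_insert ha, Finset.sum_insert ha, Multiset.countP_add, ih]

/-- `filter` is additive over finite sums of multisets. [folklore] -/
theorem filter_finset_sum {ι : Type*} (s : Finset ι) (P : Expo → Prop) [DecidablePred P] (w : ι → Multiset Expo) :
    Multiset.filter P (∑ i ∈ s, w i) = ∑ i ∈ s, Multiset.filter P (w i) := by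
  induction s using Finset.induction_on with
  | empty => simp
  | insert a s ha ih => rw [Finset.sum_insert ha, Finset.sum_insert ha, Multiset.filter_add, ih]

/-- the LETTER ASSIGNMENTS of the letters `p` (given on the rank-1 columns `R1 = {i : r i = 1}`) to the rank-1 columns: functions `f` with `f i ∈ p(R1)` on `R1`,
`f i = 0` off `R1`, and the same multiset of letters (`R1.map f = R1.map p`).  For pairwise distinct letters these are the `|R1|!` bijective re-assignments. [folklore] -/
def toricWAssign {K : ℕ} (r : Fin K → ℕ) (p : Fin K → Expo) : Finset (Fin K → Expo) :=
  (Fintype.piFinset fun i => if r i = 1 then ((Finset.univ : Finset (Fin K)).filter fun j => r j = 1).image p else {0}).filter fun f =>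
    (((Finset.univ : Finset (Fin K)).filter fun j => r j = 1).val.map f) = (((Finset.univ : Finset (Fin K)).filter fun j => r j = 1).val.map p)

/-- the decomposition of the target attached to a letter assignment `f`: column `i` takes the word `v^{k_i − r_i} ⊔ [r_i = 1]{f i}`. [folklore] -/
def toricWDecomp {K : ℕ} (k r : Fin K → ℕ) (v : Expo) (f : Fin K → Expo) (i : Fin K) : Expo :=
  (k i - r i) • v + (if r i = 1 then f i else 0)

/-- ★★ **WORD ANALYSIS (additive independence):** in a product of word sums `G_i` (`k_i` letters, `≥ r_i ∈ {0,1}` of them off the line) the coefficient of the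
target word `v^m ⊔ {p_i : r_i = 1}` (`m + #{r_i = 1} = Σ k_i ≤ N`) is the sum over the LETTER ASSIGNMENTS `f` of `Π_i coeff_{v^{k_i − r_i} ⊔ [r_i=1]{f i}} G_i` —
rank-0 factors take only `v`'s, rank-1 factors exactly one letter each. [folklore] -/
theorem coeff_prod_eq_sum_assign {u : Poly2} {v q : Expo} {N : ℕ} (hA : AddIndep u.support N) (hv : v ∈ u.support) (hqv : idet q v = 0)
    {K : ℕ} (k r : Fin K → ℕ) (hr : ∀ i, r i ≤ 1) (G : Fin K → Poly2) (hG : ∀ i, IsWordSupp u q (k i) (r i) (G i))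
    (p : Fin K → Expo) (hp : ∀ i, r i = 1 → p i ∈ u.support ∧ idet q (p i) ≠ 0) {m : ℕ}
    (hm : m + ((Finset.univ : Finset (Fin K)).filter fun j => r j = 1).card = ∑ i, k i) (hN : ∑ i, k i ≤ N) :
    coeff (m • v + ∑ i ∈ (Finset.univ : Finset (Fin K)).filter (fun j => r j = 1), p i) (∏ i, G i) =
      ∑ f ∈ toricWAssign r p, ∏ i, coeff (toricWDecomp k r v f i) (G i) := by
  set R1 : Finset (Fin K) := Finset.univ.filter fun j => r j = 1 with hR1
  set Z : Expo := m • v + ∑ i ∈ R1, p i with hZ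
  -- the standard word and its invariants
  set Wstd : Multiset Expo := Multiset.replicate m v + R1.val.map p with hWstd
  have hWstd_sum : Wstd.sum = Z := by rw [hWstd, Multiset.sum_add, Multiset.sum_replicate, hZ, Finset.sum_eq_multiset_sum]
  have hWstd_card : Multiset.card Wstd = ∑ i, k i := by
    rw [hWstd, Multiset.card_add, Multiset.card_replicate, Multiset.card_map, Finset.card_val, hm]
  have hWstd_mem : ∀ x ∈ Wstd, x ∈ u.support := by
    intro x hx
    rcases Multiset.mem_add.mp hx with h | h
    · rw [Multiset.eq_of_mem_replicate h]; exact hv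
    · obtain ⟨j, hj, rfl⟩ := Multiset.mem_map.mp h
      exact (hp j (Finset.mem_filter.mp (Finset.mem_val.mp hj)).2).1
  have hr01 : ∀ i, r i = 0 ∨ r i = 1 := fun i => by have := hr i; omega
  have hsumr : ∑ i, r i = R1.card := by
    rw [hR1, Finset.card_filter]
    exact Finset.sum_congr rfl fun i _ => by rcases hr01 i with h | h <;> simp [h]
  rw [coeff_finset_prod]
  -- ANALYSIS of a surviving decomposition `l`
  have key : ∀ l : Fin K →₀ Expo, ∑ i, l i = Z → (∏ i, coeff (l i) (G i)) ≠ 0 →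
      ∃ f ∈ toricWAssign r p, ∀ i, l i = toricWDecomp k r v f i := by
    intro l hl hne
    have hli : ∀ i, coeff (l i) (G i) ≠ 0 := fun i h0 => hne (Finset.prod_eq_zero (Finset.mem_univ i) h0)
    -- choose words
    have hw : ∀ i, ∃ w : Multiset Expo, (∀ s ∈ w, s ∈ u.support) ∧ Multiset.card w = k i ∧
        r i ≤ Multiset.card (w.filter fun s => idet q s ≠ 0) ∧ l i = w.sum :=
      fun i => hG i (l i) (MvPolynomial.mem_support_iff.mpr (hli i))
    choose w hwmem hwcard hwoff hwsum using hw
    -- the total word is the standard one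
    set W : Multiset Expo := ∑ i, w i with hW
    have hWsum : W.sum = Z := by
      rw [hW, Multiset.sum_sum, ← hl]
      exact Finset.sum_congr rfl fun i _ => (hwsum i).symm
    have hWeq : W = Wstd := by
      refine hA W Wstd (fun x hx => ?_) hWstd_mem ?_ ?_ (by rw [hWsum, hWstd_sum])
      · obtain ⟨i, -, hi⟩ := Multiset.mem_sum.mp (by rw [hW] at hx; exact hx)
        exact hwmem i x hi
      · rw [hWstd_card, hW, Multiset.card_sum]; exact Finset.sum_congr rfl fun i _ => hwcard i
      · rw [hW, Multiset.card_sum, Finset.sum_congr rfl fun i _ => hwcard i]; exact hN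
    -- off-line counts: exactly `r i` in column `i`
    have hcount : ∀ i, Multiset.card ((w i).filter fun s => idet q s ≠ 0) = r i := by
      have htot : ∑ i, Multiset.card ((w i).filter fun s => idet q s ≠ 0) = ∑ i, r i := by
        rw [hsumr]
        have h1 : ∑ i, Multiset.card ((w i).filter fun s => idet q s ≠ 0) = Multiset.card (W.filter fun s => idet q s ≠ 0) := by
          rw [hW, filter_finset_sum, Multiset.card_sum]
        rw [h1, hWeq, hWstd, Multiset.filter_add, Multiset.card_add,
          Multiset.filter_eq_nil.mpr (fun x hx => by rw [Multiset.eq_of_mem_replicate hx]; exact not_not.mpr hqv), Multiset.card_zero, zero_add,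
          Multiset.filter_eq_self.mpr (fun x hx => by
            obtain ⟨j, hj, rfl⟩ := Multiset.mem_map.mp hx; exact (hp j (Finset.mem_filter.mp (Finset.mem_val.mp hj)).2).2), Multiset.card_map,
          Finset.card_val]
      have := (Finset.sum_eq_sum_iff_of_le (fun i _ => hwoff i)).mp htot.symm
      exact fun i => (this i (Finset.mem_univ i)).symm
    -- letters of each word lie in the standard word
    have hsub : ∀ i, ∀ x ∈ w i, x = v ∨ x ∈ R1.val.map p := by
      intro i x hx
      have hle : w i ≤ W := by rw [hW]; exact Finset.single_le_sum (fun j _ => Multiset.zero_le (w j)) (Finset.mem_univ i)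
      have hx' : x ∈ Wstd := hWeq ▸ Multiset.mem_of_le hle hx
      rcases Multiset.mem_add.mp hx' with h | h
      · exact Or.inl (Multiset.eq_of_mem_replicate h)
      · exact Or.inr h
    have hoffP : ∀ x ∈ R1.val.map p, idet q x ≠ 0 := fun x hx => by
      obtain ⟨j, hj, rfl⟩ := Multiset.mem_map.mp hx; exact (hp j (Finset.mem_filter.mp (Finset.mem_val.mp hj)).2).2
    -- the on-line part of each word is `v … v`
    have hon : ∀ i, (w i).filter (fun s => ¬ idet q s ≠ 0) = Multiset.replicate (k i - r i) v := by
      intro i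
      have hall : ∀ x ∈ (w i).filter (fun s => ¬ idet q s ≠ 0), x = v := by
        intro x hx
        obtain ⟨hxw, hxon⟩ := Multiset.mem_filter.mp hx
        rcases hsub i x hxw with h | h
        · exact h
        · exact absurd (hoffP x h) hxon
      rw [Multiset.eq_replicate]
      refine ⟨?_, hall⟩
      have hsplit := congrArg Multiset.card (Multiset.filter_add_not (fun s => idet q s ≠ 0) (w i))
      rw [Multiset.card_add, hcount i, hwcard i] at hsplit
      omega
    -- the assignment
    set f : Fin K → Expo := fun i => if r i = 1 then ((w i).filter fun s => idet q s ≠ 0).sum else 0 with hf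
    have hoff1 : ∀ i, r i = 1 → (w i).filter (fun s => idet q s ≠ 0) = {f i} := by
      intro i hi
      obtain ⟨a, ha⟩ := Multiset.card_eq_one.mp ((hcount i).trans hi)
      rw [hf]; simp only [hi, if_true]; rw [ha, Multiset.sum_singleton]
    have hword : ∀ i, w i = Multiset.replicate (k i - r i) v + (if r i = 1 then {f i} else 0) := by
      intro i
      rw [← Multiset.filter_add_not (fun s => idet q s ≠ 0) (w i), hon i, add_comm]
      congr 1
      rcases hr01 i with h | h
      · rw [if_neg (by omega)]
        exact Multiset.card_eq_zero.mp ((hcount i).trans h)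
      · rw [if_pos h, hoff1 i h]
    have hdecomp : ∀ i, l i = toricWDecomp k r v f i := by
      intro i
      rw [hwsum i, hword i, Multiset.sum_add, Multiset.sum_replicate]
      unfold toricWDecomp
      rcases hr01 i with h | h
      · rw [if_neg (by omega), if_neg (by omega), Multiset.sum_zero]
      · rw [if_pos h, if_pos h, Multiset.sum_singleton]
    refine ⟨f, ?_, hdecomp⟩
    -- `f` is an assignment
    have hfmap : R1.val.map f = R1.val.map p := by
      have h1 : W.filter (fun s => idet q s ≠ 0) = R1.val.map f := by
        rw [hW, filter_finset_sum, ← Finset.sum_filter_add_sum_filter_not Finset.univ (fun j => r j = 1), ← hR1]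
        have hz : ∑ i ∈ Finset.univ.filter (fun j => ¬ r j = 1), (w i).filter (fun s => idet q s ≠ 0) = 0 :=
          Finset.sum_eq_zero fun i hi => Multiset.card_eq_zero.mp (by
            rw [hcount i]; have := (Finset.mem_filter.mp hi).2; rcases hr01 i with h | h; exact h; exact absurd h this)
        rw [hz, add_zero, ← sum_singleton_eq_map]
        exact Finset.sum_congr rfl fun i hi => hoff1 i (Finset.mem_filter.mp hi).2
      have h2 : Wstd.filter (fun s => idet q s ≠ 0) = R1.val.map p := by
        rw [hWstd, Multiset.filter_add, Multiset.filter_eq_nil.mpr (fun x hx => by rw [Multiset.eq_of_mem_replicate hx]; exact not_not.mpr hqv),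
          zero_add, Multiset.filter_eq_self.mpr hoffP]
      rw [← h1, hWeq, h2]
    unfold toricWAssign
    rw [Finset.mem_filter, Fintype.mem_piFinset]
    refine ⟨fun i => ?_, hfmap⟩
    rcases hr01 i with h | h
    · rw [if_neg (by omega), Finset.mem_singleton, hf]; simp only [h, zero_ne_one, if_false]
    · rw [if_pos h, Finset.mem_image]
      have hiR : i ∈ R1 := Finset.mem_filter.mpr ⟨Finset.mem_univ i, h⟩
      have hfi : f i ∈ R1.val.map p := by
        rw [← hfmap]; exact Multiset.mem_map.mpr ⟨i, Finset.mem_val.mpr hiR, rfl⟩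
      obtain ⟨j, hj, hfj⟩ := Multiset.mem_map.mp hfi
      exact ⟨j, Finset.mem_val.mp hj, hfj⟩
  -- SURVIVING assignments give decompositions in the antidiagonal
  have hanti : ∀ f ∈ toricWAssign r p, (∏ i, coeff (toricWDecomp k r v f i) (G i)) ≠ 0 →
      ∑ i, toricWDecomp k r v f i = Z := by
    intro f hf hne
    obtain ⟨hpi, hfmap⟩ := Finset.mem_filter.mp hf
    -- every rank-1 column has `k i ≥ 1`
    have hk1 : ∀ i, r i ≤ k i := by
      intro i
      rcases hr01 i with h | h
      · omega
      · by_contra hlt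
        have hz : coeff (toricWDecomp k r v f i) (G i) = 0 := by
          by_contra hne'
          obtain ⟨w', -, hc', hoff', -⟩ := hG i _ (MvPolynomial.mem_support_iff.mpr hne')
          have := (Multiset.card_le_card (Multiset.filter_le (fun s => idet q s ≠ 0) w')).trans_eq hc'
          omega
        exact hne (Finset.prod_eq_zero (Finset.mem_univ i) hz)
    unfold toricWDecomp
    rw [Finset.sum_add_distrib, ← Finset.sum_smul, Finset.sum_tsub_distrib _ fun i _ => hk1 i, hsumr, hZ]
    congr 1
    · congr 1; omega
    · rw [← Finset.sum_filter_add_sum_filter_not Finset.univ (fun j => r j = 1), ← hR1]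
      rw [Finset.sum_eq_zero (s := Finset.univ.filter fun j => ¬ r j = 1) (fun i hi => if_neg (Finset.mem_filter.mp hi).2), add_zero,
        Finset.sum_congr rfl (fun i hi => if_pos (Finset.mem_filter.mp hi).2), Finset.sum_eq_multiset_sum, Finset.sum_eq_multiset_sum, hfmap]
  -- the bijection on non-zero terms (stated over the canonically-decidable antidiagonal, then transported)
  have main : (∑ l ∈ (Finset.univ : Finset (Fin K)).finsuppAntidiag Z, ∏ i, coeff (l i) (G i)) =
      ∑ f ∈ toricWAssign r p, ∏ i, coeff (toricWDecomp k r v f i) (G i) := by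
    refine Finset.sum_bij_ne_zero (fun l hl hne => (key l (Finset.mem_finsuppAntidiag.mp hl).1 hne).choose) ?_ ?_ ?_ ?_
    · intro l hl hne
      exact (key l (Finset.mem_finsuppAntidiag.mp hl).1 hne).choose_spec.1
    · intro l₁ h₁ hne₁ l₂ h₂ hne₂ heq
      have e₁ := (key l₁ (Finset.mem_finsuppAntidiag.mp h₁).1 hne₁).choose_spec.2
      have e₂ := (key l₂ (Finset.mem_finsuppAntidiag.mp h₂).1 hne₂).choose_spec.2
      exact Finsupp.ext fun i => by rw [e₁ i, e₂ i, heq]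
    · intro f hf hne
      set lf : Fin K →₀ Expo := Finsupp.equivFunOnFinite.symm (toricWDecomp k r v f) with hlf
      have hlfi : ∀ i, lf i = toricWDecomp k r v f i := fun i => by rw [hlf, Finsupp.coe_equivFunOnFinite_symm]
      have hne' : (∏ i, coeff (lf i) (G i)) ≠ 0 := by
        rw [Finset.prod_congr rfl fun i _ => by rw [hlfi i]]; exact hne
      have hsum' : ∑ i, lf i = Z := by rw [Finset.sum_congr rfl fun i _ => hlfi i]; exact hanti f hf hne
      have hmem : lf ∈ (Finset.univ : Finset (Fin K)).finsuppAntidiag Z := Finset.mem_finsuppAntidiag.mpr ⟨hsum', Finset.subset_univ _⟩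
      refine ⟨lf, hmem, hne', ?_⟩
      obtain ⟨hf'mem, hf'eq⟩ := (key lf (Finset.mem_finsuppAntidiag.mp hmem).1 hne').choose_spec
      obtain ⟨hpi, -⟩ := Finset.mem_filter.mp hf
      obtain ⟨hpi', -⟩ := Finset.mem_filter.mp hf'mem
      funext i
      have h := hf'eq i
      rw [hlfi i] at h
      unfold toricWDecomp at h
      have h1 := Fintype.mem_piFinset.mp hpi i
      have h2 := Fintype.mem_piFinset.mp hpi' i
      rcases hr01 i with h0 | h0
      · rw [if_neg (by omega)] at h1 h2
        rw [Finset.mem_singleton.mp h1, Finset.mem_singleton.mp h2]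
      · rw [if_pos h0, if_pos h0] at h
        exact (add_left_cancel h).symm
    · intro l hl hne
      have e := (key l (Finset.mem_finsuppAntidiag.mp hl).1 hne).choose_spec.2
      exact Finset.prod_congr rfl fun i _ => by rw [e i]
  convert main using 2
  congr 1
  exact Subsingleton.elim _ _


end TowerKernel

end Summit.ValiantsHypothesis.ValiantsHypothesis.Theorems.TwoProducts.RankTwoJacobian

end
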